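import Literature.NumberTheory.EllipticCurves.PastenValuationProduct
import Literature.NumberTheory.EllipticCurves.ShafarevichGoodReductionProofs
import Literature.NumberTheory.DiophantineGeometry.PastenValuationProducts
import Literature.NumberTheory.DiophantineGeometry.ValuationProductElliptic
import Literature.NumberTheory.DiophantineGeometry.ConductorFactorizationProofs
import Literature.NumberTheory.DiophantineGeometry.ConductorMultiplicativeProofs
import Literature.NumberTheory.DiophantineGeometry.ConductorExponentZeroProofs
import Literature.NumberTheory.DiophantineGeometry.ConductorRingOfIntegersProofs
import Literature.NumberTheory.DiophantineGeometry.MinimalDiscriminantFactorizationProofs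
import Literature.NumberTheory.DiophantineGeometry.MinimalDiscriminantSmulProofs
import Literature.NumberTheory.DiophantineGeometry.TateAlgorithmInvarianceProofs
import HarnessLib

/-!
# Pasten's Theorem 1.12 / 16.5 and Corollary 16.2 over `ℚ`: the renderings agree (proofs)

Topic `NumberTheory/EllipticCurves`; namespace `Literature.NumberTheory.EllipticCurves`.
A *proofs* sibling (theorems only) of
`Literature.NumberTheory.EllipticCurves.PastenValuationProduct` (§16.3 "The semi-stable case").

H. Pasten, *Shimura curves and the abc conjecture*, J. Number Theory 254 (2024) 214–335
(arXiv:1705.09251, held; pp. 8, 49–50 of the arXiv text). Theorem 1.12 = Theorem 16.5: for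
every `ε > 0` there is `K_ε > 0` with `∏_{p ∣ N_E} v_p(Δ_E) < K_ε · N_E^{11/2+ε}` for all
semistable `E/ℚ`, and `< K_ε · N_E^{8/3+ε}` once `E` has at least `3 + 11/ε` bad places;
Corollary 16.2: for `E` semistable away from a finite `S` with `≥ 2` multiplicative primes,
`∏_{p ∣ N_E^*} v_p(Δ_E) < N_E^{11/2+ε}` for all but finitely many `E`.

The tree states both results several times as unproved named facts. This directory's
`pasten_thm_1_12` (both displays, one constant; semistable = `W.IsSemistable ℤ`) and
`pasten_cor_16_2` (finite places of `ℤ`: `IsSemistableAt`, `HasMultiplicativeReductionAt`,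
`ordMinimalDiscriminant`; "all but finitely many `E`" kept as a conductor threshold
`N_E ≥ N₀(S, ε)`) face, in `Literature.NumberTheory.DiophantineGeometry`, the pairs
`pasten_valuationProduct_semistable` / `…_manyPrimes`, `pastenShimura2024_thm_1_12` /
`pastenShimura2024_thm_16_5_manyPrimes` (semistable = `Squarefree N_E`) and the two
definitionally equal constant forms `pasten_valuationProduct_awayFrom`,
`pastenShimura2024_cor_16_2` of Corollary 16.2 (reduction types read off the exponents of `N_E`,
exceptions absorbed into `K_{S,ε}`). This file identifies the renderings of this directory with
those, unconditionally, and runs the first paragraph of the printed proof of Theorem 16.5: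

* `pasten_thm_1_12_iff_valuationProduct`, `pasten_thm_1_12_iff_pastenShimura2024` —
  `pasten_thm_1_12 ↔` (first display) `∧` (second display), for either pair (one constant:
  take the `max`; `IsSemistable ℤ ↔ Squarefree N_E`, Silverman ATAEC IV.10.2, proved in the
  tree in `DiophantineGeometry.PastenValuationProductsProofs`, private copy here);
* `pasten_cor_16_2_iff_pastenShimura2024_cor_16_2`,
  `pasten_cor_16_2_iff_pasten_valuationProduct_awayFrom` — the threshold/places form IS the
  constant/exponent form. Dictionary (Silverman ATAEC IV.10.2,
  discharged in the tree: `conductorExponent_eq_zero_iff_holds`, `…_eq_one_iff_holds`,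
  `factorization_conductorNorm_holds`, `factorization_minimalDiscriminantNorm_holds`):
  semistable at `v` iff `f_v ≤ 1` iff `p_v² ∤ N_E`; multiplicative at `v` iff `f_v = 1` iff
  `p_v ∣ N_E ∧ p_v² ∤ N_E` (`finprod_mem_ordMinimalDiscriminant_eq_multiplicativeValuationProduct`,
  `exists_two_hasMultiplicativeReductionAt_iff`, `forall_isSemistableAt_iff`). Constant ⇒
  threshold: `ε/2` and `N₀ = ⌈K^{2/ε}⌉`. Threshold ⇒ constant: the curves of conductor `< N₀`
  have bad places over primes `< N₀`, hence (Shafarevich, Silverman AEC IX.6.1, the discharged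
  `WeierstrassCurve.shafarevich_finite_goodReductionOutside_holds`) fall into finitely many
  `ℚ`-isomorphism classes, on which `N_E` and `|Δ_min|` — so the product — are constant
  (`exists_multiplicativeValuationProduct_le_of_conductorNorm_lt`); this is how print passes
  from "all but finitely many `E`" to a constant (Cor 16.3 ⇒ Thm 1.15, p. 50);
* `pasten_valuationProduct_semistable_of_cor_16_2 : pasten_cor_16_2 →
  mestreOesterle_factorization_le_five → pasten_valuationProduct_semistable` — the printed proof
  of Theorem 16.5, first part: "If `N_E = p` is prime then `v_p(Δ_E) ≤ 5` (cf. [MestreOesterle]).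
  The first part of the result now follows from Corollary 16.2 with `S = ∅`." (constant form with
  `S = ∅` for `ω(N_E) ≥ 2`; `N_E = p`: the product is `v_p(Δ_E) ≤ 5`; `N_E = 1`: empty
  product); and `pasten_thm_1_12_of_cor_16_2`, adding the second display as the hypothesis
  `pasten_valuationProduct_semistable_manyPrimes` (Theorem 16.5, second part, whose printed
  proof rests on Theorem 16.4 (i), not a fact of the tree).

Deliberately NOT here: proofs of Theorem 16.5 / Corollary 16.2 themselves (Theorem 16.1:
Shimura-curve parametrisations `X_0^D(M) → E`, Jacquet–Langlands, the Ribet–Takahashi formula,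
Arakelov-type lower bounds for integral quaternionic forms, modularity of `E/ℚ` — a theory that
neither Mathlib nor `Literature/` has). Remark for users of the second display: the printed proof
needs `n > 3 + 11/ε` bad places STRICTLY (`(8/3+ε')·n/(n-3) + 3/(n-3) < 8/3 + ε` iff
`11/(n-3) + ε'n/(n-3) < ε`), while the printed statement, copied verbatim by all vendorings, says
"at least `3 + 11/ε`"; the two differ only when `11/ε ∈ ℕ`.

## References

* [PastenShimura2024] H. Pasten, *Shimura curves and the abc conjecture*, J. Number Theory 254
  (2024) 214–335, doi:10.1016/j.jnt.2023.07.002, arXiv:1705.09251 — Thm 1.12 (p. 8), Cor 16.2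
  (p. 49), Thm 16.5 and its proof, Cor 16.3 ⇒ Thm 1.15 (p. 50); arXiv numbering.
* [Silverman1994] J. H. Silverman, *Advanced Topics in the Arithmetic of Elliptic Curves*,
  GTM 151, Thm IV.10.2.
* [SilvermanAEC2009] J. H. Silverman, *The Arithmetic of Elliptic Curves*, 2nd ed., Thm IX.6.1.
-/

noncomputable section

open IsDedekindDomain NumberField Rat.HeightOneSpectrum

namespace Literature.NumberTheory.EllipticCurves

open Literature.NumberTheory.DiophantineGeometry

/-! ### Dictionary: reduction types versus exponents of the conductor (Silverman ATAEC IV.10.2) -/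

section Dictionary

variable (W : WeierstrassCurve ℚ) [W.IsElliptic]

/-- `natGenerator : HeightOneSpectrum ℤ → ℕ` is injective (first component of Mathlib's
`Rat.HeightOneSpectrum.primesEquiv`). [folklore] -/
private theorem natGenerator_injective' : Function.Injective (natGenerator (R := ℤ)) :=
  fun _ _ h ↦ primesEquiv.injective (Subtype.ext h)

/-- The rational prime below the place `primesEquiv.symm p` is `p`. [folklore] -/
private theorem natGenerator_primesEquiv_symm' (p : Nat.Primes) :
    natGenerator ((primesEquiv (R := ℤ)).symm p) = p :=
  congrArg Subtype.val ((primesEquiv (R := ℤ)).apply_symm_apply p)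

/-- `f_v` is the exponent of `p_v` in `N_E` (`factorization_conductorNorm_holds`, with the
instance argument consumed, for rewriting). [folklore] -/
private theorem factorization_natGenerator (v : HeightOneSpectrum ℤ) :
    (W.conductorNorm ℤ).factorization (natGenerator v) = W.conductorExponent v :=
  WeierstrassCurve.factorization_conductorNorm_holds W v

/-- Semistable at `v` iff `f_v ≤ 1` (good: `f_v = 0`, multiplicative: `f_v = 1`;
Silverman ATAEC IV.10.2 (a),(b), the discharged `conductorExponent_eq_zero_iff_holds`,
`conductorExponent_eq_one_iff_holds`). [cite: Silverman1994, IV.10.2] -/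
private theorem isSemistableAt_iff_conductorExponent_le_one (v : HeightOneSpectrum ℤ) :
    W.IsSemistableAt v ↔ W.conductorExponent v ≤ 1 := by
  have h0 : W.conductorExponent v = 0 ↔ W.HasGoodReductionAt v :=
    WeierstrassCurve.conductorExponent_eq_zero_iff_holds v W
  have h1 : W.conductorExponent v = 1 ↔ W.HasMultiplicativeReductionAt v :=
    WeierstrassCurve.conductorExponent_eq_one_iff_holds v W
  rw [WeierstrassCurve.IsSemistableAt, ← h0, ← h1]
  omega

/-- Semistable at `v` iff `p_v² ∤ N_E` (`f_v ≤ 1` iff the exponent of `p_v` in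
`N_E = ∏ p^{f_p}` is `≤ 1`). [cite: Silverman1994, IV.10.2] -/
private theorem isSemistableAt_iff_not_sq_dvd (v : HeightOneSpectrum ℤ) :
    W.IsSemistableAt v ↔ ¬ natGenerator v ^ 2 ∣ W.conductorNorm ℤ := by
  rw [isSemistableAt_iff_conductorExponent_le_one,
    (prime_natGenerator v).pow_dvd_iff_le_factorization
      (WeierstrassCurve.conductorNorm_pos_holds W).ne', factorization_natGenerator]
  omega

/-- **Semistable iff squarefree conductor** (elliptic `W/ℚ`; Silverman ATAEC IV.10.2). Private
copy of the tree's `WeierstrassCurve.isSemistable_(int_)iff_squarefree_conductorNorm`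
(`DiophantineGeometry.PastenValuationProductsProofs`), kept local so that this file depends
only on the statement files of the facts it relates. [cite: Silverman1994, IV.10.2] -/
private theorem isSemistable_iff_squarefree :
    W.IsSemistable ℤ ↔ Squarefree (W.conductorNorm ℤ) := by
  rw [Nat.squarefree_iff_factorization_le_one (WeierstrassCurve.conductorNorm_pos_holds W).ne',
    WeierstrassCurve.IsSemistable]
  constructor
  · intro h p
    by_cases hp : p.Prime
    · have hgen : natGenerator ((primesEquiv (R := ℤ)).symm ⟨p, hp⟩) = p :=
        natGenerator_primesEquiv_symm' ⟨p, hp⟩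
      have hv := h ((primesEquiv (R := ℤ)).symm ⟨p, hp⟩)
      rw [isSemistableAt_iff_conductorExponent_le_one, ← factorization_natGenerator, hgen] at hv
      exact hv
    · rw [Nat.factorization_eq_zero_of_not_prime _ hp]
      exact zero_le_one
  · intro h v
    rw [isSemistableAt_iff_conductorExponent_le_one, ← factorization_natGenerator]
    exact h _

/-- Multiplicative reduction at `v` iff `p_v ∣ N_E` and `p_v² ∤ N_E` (`f_v = 1`), i.e. iff `p_v`
lies in the filtered set of prime factors over which `multiplicativeValuationProduct` runs.
[cite: Silverman1994, IV.10.2] -/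
private theorem hasMultiplicativeReductionAt_iff_mem_filter (v : HeightOneSpectrum ℤ) :
    W.HasMultiplicativeReductionAt v ↔ natGenerator v ∈
      (W.conductorNorm ℤ).primeFactors.filter (fun p ↦ ¬ p ^ 2 ∣ W.conductorNorm ℤ) := by
  have h1 : W.conductorExponent v = 1 ↔ W.HasMultiplicativeReductionAt v :=
    WeierstrassCurve.conductorExponent_eq_one_iff_holds v W
  rw [Finset.mem_filter, ← isSemistableAt_iff_not_sq_dvd,
    isSemistableAt_iff_conductorExponent_le_one, ← h1, ← Nat.support_factorization,
    Finsupp.mem_support_iff, factorization_natGenerator]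
  omega

/-- A bad place lies over a prime factor of the conductor: not good at `v` means `f_v ≠ 0`
(Silverman ATAEC IV.10.2 (a)), i.e. `p_v` is in the support of `N_E = ∏ p^{f_p}`.
[cite: Silverman1994, IV.10.2] -/
private theorem natGenerator_mem_primeFactors_of_not_hasGoodReductionAt (v : HeightOneSpectrum ℤ)
    (h : ¬ W.HasGoodReductionAt v) : natGenerator v ∈ (W.conductorNorm ℤ).primeFactors := by
  have h0 : W.conductorExponent v = 0 ↔ W.HasGoodReductionAt v :=
    WeierstrassCurve.conductorExponent_eq_zero_iff_holds v W
  rw [← Nat.support_factorization, Finsupp.mem_support_iff, factorization_natGenerator]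
  exact fun hf ↦ h (h0.mp hf)

/-- `v ↦ p_v` is a bijection from the places of multiplicative reduction of an elliptic `W/ℚ` onto
the primes `p ∣ N_E` with `p² ∤ N_E`. [cite: Silverman1994, IV.10.2] -/
private theorem bijOn_natGenerator_filter :
    Set.BijOn (natGenerator (R := ℤ)) {v | W.HasMultiplicativeReductionAt v}
      ↑((W.conductorNorm ℤ).primeFactors.filter (fun p ↦ ¬ p ^ 2 ∣ W.conductorNorm ℤ)) := by
  refine ⟨fun v hv ↦ ?_, fun v _ w _ h ↦ natGenerator_injective' h, fun p hp ↦ ?_⟩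
  · exact Finset.mem_coe.mpr ((hasMultiplicativeReductionAt_iff_mem_filter W v).mp hv)
  · have hp' : p.Prime :=
      Nat.prime_of_mem_primeFactors (Finset.mem_filter.mp (Finset.mem_coe.mp hp)).1
    refine ⟨(primesEquiv (R := ℤ)).symm ⟨p, hp'⟩, ?_,
      natGenerator_primesEquiv_symm' ⟨p, hp'⟩⟩
    show W.HasMultiplicativeReductionAt _
    rw [hasMultiplicativeReductionAt_iff_mem_filter W, natGenerator_primesEquiv_symm']
    exact Finset.mem_coe.mp hp

/-- **Dictionary for Corollary 16.2.** For an elliptic `W/ℚ`, the `finprod` of `ord_v(Δ_min)`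
over the places of multiplicative reduction (`pasten_cor_16_2`) is
`multiplicativeValuationProduct W = ∏_{p ∣ N_E, p² ∤ N_E} v_p(|Δ_min|)`
(`pastenShimura2024_cor_16_2`): reindex along `v ↦ p_v` (`bijOn_natGenerator_filter`) using
`ord_v(Δ_min) = v_{p_v}(|Δ_min|)` (`factorization_minimalDiscriminantNorm_holds`).
[cite: PastenShimura2024, Corollary 16.2] -/
theorem finprod_mem_ordMinimalDiscriminant_eq_multiplicativeValuationProduct :
    ∏ᶠ v ∈ {v : HeightOneSpectrum ℤ | W.HasMultiplicativeReductionAt v},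
        W.ordMinimalDiscriminant v = multiplicativeValuationProduct W := by
  rw [multiplicativeValuationProduct_def,
    finprod_mem_eq_of_bijOn (g := fun p : ℕ ↦ (W.minimalDiscriminantNorm ℤ).factorization p)
      natGenerator (bijOn_natGenerator_filter W) fun v _ ↦ ?_, finprod_mem_coe_finset]
  exact (WeierstrassCurve.factorization_minimalDiscriminantNorm_holds W v).symm

/-- Semistable special case of the dictionary: for a semistable elliptic `W/ℚ` (squarefree
`N_E`, every bad prime multiplicative) the `finprod` of `pasten_cor_16_2` is the full product
`∏_{p ∣ N_E} v_p(|Δ_min|)` of `pasten_thm_1_12`. [cite: PastenShimura2024, Theorem 16.5] -/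
theorem finprod_mem_ordMinimalDiscriminant_eq_prod_primeFactors (hW : W.IsSemistable ℤ) :
    ∏ᶠ v ∈ {v : HeightOneSpectrum ℤ | W.HasMultiplicativeReductionAt v},
        W.ordMinimalDiscriminant v =
      ∏ p ∈ (W.conductorNorm ℤ).primeFactors, (W.minimalDiscriminantNorm ℤ).factorization p := by
  rw [finprod_mem_ordMinimalDiscriminant_eq_multiplicativeValuationProduct,
    multiplicativeValuationProduct_eq_of_squarefree W ((isSemistable_iff_squarefree W).mp hW)]

/-- "At least two primes of multiplicative reduction": two distinct places of multiplicative
reduction iff the set of primes `p ∣ N_E`, `p² ∤ N_E` has at least two elements.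
[cite: PastenShimura2024, Corollary 16.2] -/
theorem exists_two_hasMultiplicativeReductionAt_iff :
    (∃ v w : HeightOneSpectrum ℤ, v ≠ w ∧
        W.HasMultiplicativeReductionAt v ∧ W.HasMultiplicativeReductionAt w) ↔
      2 ≤ ((W.conductorNorm ℤ).primeFactors.filter
        (fun p ↦ ¬ p ^ 2 ∣ W.conductorNorm ℤ)).card := by
  constructor
  · rintro ⟨v, w, hvw, hv, hw⟩
    exact Finset.one_lt_card.mpr ⟨_, (hasMultiplicativeReductionAt_iff_mem_filter W v).mp hv, _,
      (hasMultiplicativeReductionAt_iff_mem_filter W w).mp hw,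
      fun h ↦ hvw (natGenerator_injective' h)⟩
  · intro h2
    obtain ⟨p, hp, q, hq, hpq⟩ := Finset.one_lt_card.mp h2
    obtain ⟨v, hv, rfl⟩ := (bijOn_natGenerator_filter W).surjOn (Finset.mem_coe.mpr hp)
    obtain ⟨w, hw, rfl⟩ := (bijOn_natGenerator_filter W).surjOn (Finset.mem_coe.mpr hq)
    exact ⟨v, w, ne_of_apply_ne _ hpq, hv, hw⟩

/-- "Semi-stable away from `S`": semistable at every place over a prime outside `S` iff
`p² ∤ N_E` for every prime `p ∉ S`. [cite: PastenShimura2024, Corollary 16.2] -/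
theorem forall_isSemistableAt_iff (S : Finset ℕ) :
    (∀ v : HeightOneSpectrum ℤ, natGenerator v ∉ S → W.IsSemistableAt v) ↔
      ∀ p : ℕ, p.Prime → p ∉ S → ¬ p ^ 2 ∣ W.conductorNorm ℤ := by
  constructor
  · intro h p hp hpS
    have := h ((primesEquiv (R := ℤ)).symm ⟨p, hp⟩)
    rw [natGenerator_primesEquiv_symm', isSemistableAt_iff_not_sq_dvd,
      natGenerator_primesEquiv_symm'] at this
    exact this hpS
  · intro h v hvS
    exact (isSemistableAt_iff_not_sq_dvd W v).mpr (h _ (prime_natGenerator v) hvS)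

/-! ### Bounded conductor: finitely many curves (Shafarevich) -/

/-- `∏_{p ∣ N_E, p² ∤ N_E} v_p(|Δ_min|)` is an isomorphism invariant of `E/ℚ`: it is a function
of `N_E` and `|Δ_min|`, both invariant under admissible changes of variables
(`WeierstrassCurve.conductor_smul` with the discharged `ordMinimalDiscriminant_smul_holds`,
`kodairaSymbol_smul_holds`; Silverman ATAEC IV.10, AEC VIII.8). [folklore] -/
private theorem multiplicativeValuationProduct_smul (C : WeierstrassCurve.VariableChange ℚ) :
    multiplicativeValuationProduct (C • W) = multiplicativeValuationProduct W := by
  have hN : (C • W).conductorNorm ℤ = W.conductorNorm ℤ := by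
    unfold WeierstrassCurve.conductorNorm
    rw [WeierstrassCurve.conductor_smul ℤ W
      (fun v ↦ WeierstrassCurve.ordMinimalDiscriminant_smul_holds v W)
      (fun v ↦ WeierstrassCurve.kodairaSymbol_smul_holds _) C]
  have hΔ : (C • W).minimalDiscriminantNorm ℤ = W.minimalDiscriminantNorm ℤ := by
    simp only [WeierstrassCurve.minimalDiscriminantNorm, WeierstrassCurve.minimalDiscriminantIdeal,
      WeierstrassCurve.ordMinimalDiscriminant_smul_holds _ W C]
  rw [multiplicativeValuationProduct_def, multiplicativeValuationProduct_def, hN, hΔ]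

omit W in
/-- **Absorbing the exceptions of Corollary 16.2 into a constant.** The products
`∏_{p ∣ N_E, p² ∤ N_E} v_p(|Δ_min|)` of the elliptic curves over `ℚ` of conductor `< N₀` are
bounded: the bad places of such a curve lie over primes `p ∣ N_E`, `p < N₀` (Silverman ATAEC
IV.10.2(a), through the `𝓞 ℚ`/`ℤ` bridge `conductorExponent_ringOfIntegers_eq`); by
**Shafarevich's theorem** (Silverman AEC IX.6.1, the discharged
`WeierstrassCurve.shafarevich_finite_goodReductionOutside_holds`) these curves fall into finitely
many `ℚ`-isomorphism classes of Weierstrass models, and the product is an isomorphism invariant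
(`multiplicativeValuationProduct_smul`). [cite: SilvermanAEC2009, Thm. IX.6.1] -/
theorem exists_multiplicativeValuationProduct_le_of_conductorNorm_lt (N₀ : ℕ) :
    ∃ K₁ : ℝ, 0 ≤ K₁ ∧ ∀ (W : WeierstrassCurve ℚ) [W.IsElliptic],
      W.conductorNorm ℤ < N₀ → (multiplicativeValuationProduct W : ℝ) ≤ K₁ := by
  classical
  -- the finite set of places of `𝓞 ℚ` above the primes `< N₀`
  set S₀ : Set (HeightOneSpectrum (𝓞 ℚ)) :=
    (fun w : HeightOneSpectrum (𝓞 ℚ) ↦ (primesEquiv w : ℕ)) ⁻¹' Set.Iio N₀ with hS₀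
  have hS₀fin : S₀.Finite :=
    (Set.finite_Iio N₀).preimage fun w _ w' _ h ↦ primesEquiv.injective (Subtype.ext h)
  obtain ⟨F, hF⟩ := WeierstrassCurve.shafarevich_finite_goodReductionOutside_holds ℚ S₀ hS₀fin
  refine ⟨∑ X ∈ F, (multiplicativeValuationProduct X : ℝ),
    Finset.sum_nonneg fun _ _ ↦ Nat.cast_nonneg _, ?_⟩
  intro W _ hN
  have hbad : W.badPlaces (𝓞 ℚ) ⊆ S₀ := by
    intro w hw
    rw [WeierstrassCurve.mem_badPlaces_iff] at hw
    show (primesEquiv w : ℕ) < N₀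
    -- descend to the place of `ℤ` below the same prime
    have hfw : W.conductorExponent w ≠ 0 := fun h0 ↦
      hw ((WeierstrassCurve.conductorExponent_eq_zero_iff_holds w W).mp h0)
    rw [WeierstrassCurve.conductorExponent_ringOfIntegers_eq W w] at hfw
    have h0 : W.conductorExponent ((primesEquiv (R := ℤ)).symm (primesEquiv w)) = 0 ↔
        W.HasGoodReductionAt ((primesEquiv (R := ℤ)).symm (primesEquiv w)) :=
      WeierstrassCurve.conductorExponent_eq_zero_iff_holds _ W
    have hmem := natGenerator_mem_primeFactors_of_not_hasGoodReductionAt W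
      ((primesEquiv (R := ℤ)).symm (primesEquiv w)) fun hg ↦ hfw (h0.mpr hg)
    rw [natGenerator_primesEquiv_symm'] at hmem
    exact lt_of_le_of_lt (Nat.le_of_mem_primeFactors hmem) hN
  obtain ⟨C, hC⟩ := hF W hbad
  rw [← multiplicativeValuationProduct_smul W C]
  exact Finset.single_le_sum (f := fun X : WeierstrassCurve ℚ ↦
    (multiplicativeValuationProduct X : ℝ)) (fun X _ ↦ Nat.cast_nonneg _) hC

end Dictionary

/-! ### Corollary 16.2: the threshold form and the constant form are equivalent -/

/-- **Corollary 16.2: constant form ⇒ threshold form.** Apply the constant form with `ε/2`; for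
`N_E ≥ N₀ = ⌈K^{2/ε}⌉` one has `K ≤ N_E^{ε/2}`, so `K · N_E^{11/2+ε/2} ≤ N_E^{11/2+ε}`; the
hypotheses and the products are matched by the dictionary above.
[cite: PastenShimura2024, Corollary 16.2] -/
theorem pasten_cor_16_2_of_pastenShimura2024_cor_16_2 (h : pastenShimura2024_cor_16_2) :
    pasten_cor_16_2 := by
  intro S ε hε
  obtain ⟨K, hK, hKW⟩ := h S (ε / 2) (half_pos hε)
  refine ⟨⌈K ^ (2 / ε)⌉₊, fun W _ hS h2 hN ↦ ?_⟩
  have hNpos : (0 : ℝ) < W.conductorNorm ℤ := by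
    exact_mod_cast WeierstrassCurve.conductorNorm_pos_holds W
  have hKN : K ≤ (W.conductorNorm ℤ : ℝ) ^ (ε / 2) := by
    have hle : K ^ (2 / ε) ≤ (W.conductorNorm ℤ : ℝ) :=
      (Nat.le_ceil _).trans (by exact_mod_cast hN)
    calc K = (K ^ (2 / ε)) ^ (ε / 2) := by
          rw [← Real.rpow_mul hK.le, show 2 / ε * (ε / 2) = 1 by field_simp, Real.rpow_one]
      _ ≤ (W.conductorNorm ℤ : ℝ) ^ (ε / 2) :=
          Real.rpow_le_rpow (Real.rpow_nonneg hK.le _) hle (half_pos hε).le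
  have hlt := hKW W ((forall_isSemistableAt_iff W S).mp hS)
    ((exists_two_hasMultiplicativeReductionAt_iff W).mp h2)
  rw [← finprod_mem_ordMinimalDiscriminant_eq_multiplicativeValuationProduct W] at hlt
  calc _ < K * (W.conductorNorm ℤ : ℝ) ^ (11 / 2 + ε / 2 : ℝ) := hlt
    _ ≤ (W.conductorNorm ℤ : ℝ) ^ (ε / 2) * (W.conductorNorm ℤ : ℝ) ^ (11 / 2 + ε / 2 : ℝ) :=
        mul_le_mul_of_nonneg_right hKN (Real.rpow_nonneg hNpos.le _)
    _ = (W.conductorNorm ℤ : ℝ) ^ (11 / 2 + ε : ℝ) := by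
        rw [← Real.rpow_add hNpos]; ring_nf

/-- **Corollary 16.2: threshold form ⇒ constant form** — how print absorbs "all but finitely
many `E`" into a constant (as in Cor 16.3 ⇒ Thm 1.15): for `N_E ≥ N₀(S, ε)` the threshold form
gives `∏ < N_E^{11/2+ε}`, and the curves of conductor `< N₀` have bounded product by Shafarevich
(`exists_multiplicativeValuationProduct_le_of_conductorNorm_lt`); `K_{S,ε} = K₁ + 1`.
[cite: PastenShimura2024, Corollary 16.2] -/
theorem pastenShimura2024_cor_16_2_of_pasten_cor_16_2 (h : pasten_cor_16_2) :
    pastenShimura2024_cor_16_2 := by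
  intro S ε hε
  obtain ⟨N₀, hN₀⟩ := h S ε hε
  obtain ⟨K₁, hK₁, hsmall⟩ := exists_multiplicativeValuationProduct_le_of_conductorNorm_lt N₀
  refine ⟨K₁ + 1, by linarith, fun W _ hS h2 ↦ ?_⟩
  have hNpos : 0 < W.conductorNorm ℤ := WeierstrassCurve.conductorNorm_pos_holds W
  have hrpow : 1 ≤ (W.conductorNorm ℤ : ℝ) ^ (11 / 2 + ε : ℝ) :=
    Real.one_le_rpow (by exact_mod_cast hNpos) (by positivity)
  have hKle : K₁ + 1 ≤ (K₁ + 1) * (W.conductorNorm ℤ : ℝ) ^ (11 / 2 + ε : ℝ) :=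
    le_mul_of_one_le_right (by linarith) hrpow
  by_cases hlt : W.conductorNorm ℤ < N₀
  · have := hsmall W hlt
    linarith
  · have h' := hN₀ W ((forall_isSemistableAt_iff W S).mpr hS)
      ((exists_two_hasMultiplicativeReductionAt_iff W).mpr h2) (not_lt.mp hlt)
    rw [finprod_mem_ordMinimalDiscriminant_eq_multiplicativeValuationProduct W] at h'
    exact h'.trans_le (le_mul_of_one_le_left (by positivity) (by linarith))

/-- **Corollary 16.2: the places/threshold rendering of this directory IS the exponent/constant
rendering of `DiophantineGeometry`.** [cite: PastenShimura2024, Corollary 16.2] -/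
theorem pasten_cor_16_2_iff_pastenShimura2024_cor_16_2 :
    pasten_cor_16_2 ↔ pastenShimura2024_cor_16_2 :=
  ⟨pastenShimura2024_cor_16_2_of_pasten_cor_16_2, pasten_cor_16_2_of_pastenShimura2024_cor_16_2⟩

/-- … and IS the third rendering `pasten_valuationProduct_awayFrom`, which is definitionally
`pastenShimura2024_cor_16_2` (`multiplicativeValuationProduct W` unfolds to the filtered
product). [cite: PastenShimura2024, Corollary 16.2] -/
theorem pasten_cor_16_2_iff_pasten_valuationProduct_awayFrom :
    pasten_cor_16_2 ↔ pasten_valuationProduct_awayFrom :=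
  pasten_cor_16_2_iff_pastenShimura2024_cor_16_2

/-! ### Theorem 1.12 / 16.5: one statement with two displays versus two statements -/

/-- `K · N^s` is monotone in the constant `K` (`N : ℕ`, real exponent `s`): merging the two
constants of separately vendored displays into one `K_ε`. [folklore] -/
private theorem const_mul_rpow_mono {K K' : ℝ} (h : K ≤ K') (N : ℕ) (s : ℝ) :
    K * (N : ℝ) ^ s ≤ K' * (N : ℝ) ^ s :=
  mul_le_mul_of_nonneg_right h (Real.rpow_nonneg (Nat.cast_nonneg N) s)

/-- **`pasten_thm_1_12` is the conjunction of the two `DiophantineGeometry` vendorings over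
`IsSemistable`.** The displays agree literally (`valuationProduct W = ∏_{p ∣ N_W} v_p(Δ_min)`,
`valuationProduct_def`); `pasten_thm_1_12` merely uses one constant `K_ε` for both (take the
`max` of the two). [cite: PastenShimura2024, Theorem 1.12 and Theorem 16.5] -/
theorem pasten_thm_1_12_iff_valuationProduct :
    pasten_thm_1_12 ↔
      pasten_valuationProduct_semistable ∧ pasten_valuationProduct_semistable_manyPrimes := by
  constructor
  · intro h
    refine ⟨fun ε hε ↦ ?_, fun ε hε ↦ ?_⟩
    · obtain ⟨K, hK, h₁, -⟩ := h ε hε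
      exact ⟨K, hK, fun W _ hW ↦ by simpa only [valuationProduct_def] using h₁ W hW⟩
    · obtain ⟨K, hK, -, h₂⟩ := h ε hε
      exact ⟨K, hK, fun W _ hW hn ↦ by simpa only [valuationProduct_def] using h₂ W hW hn⟩
  · rintro ⟨h₁, h₂⟩ ε hε
    obtain ⟨K₁, hK₁, h₁⟩ := h₁ ε hε
    obtain ⟨K₂, hK₂, h₂⟩ := h₂ ε hε
    refine ⟨max K₁ K₂, lt_max_of_lt_left hK₁, fun W _ hW ↦ ?_, fun W _ hW hn ↦ ?_⟩
    · have := h₁ W hW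
      rw [valuationProduct_def] at this
      exact this.trans_le (const_mul_rpow_mono (le_max_left K₁ K₂) _ _)
    · have := h₂ W hW hn
      rw [valuationProduct_def] at this
      exact this.trans_le (const_mul_rpow_mono (le_max_right K₁ K₂) _ _)

/-- **`pasten_thm_1_12` is the conjunction of the two `DiophantineGeometry` vendorings over
`Squarefree N_E`** ("semi-stable" is `W.IsSemistable ℤ` on the left and
`Squarefree (W.conductorNorm ℤ)` on the right — the same condition for elliptic `W/ℚ`,
Silverman ATAEC IV.10.2). [cite: PastenShimura2024, Theorem 1.12 and Theorem 16.5] -/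
theorem pasten_thm_1_12_iff_pastenShimura2024 :
    pasten_thm_1_12 ↔ pastenShimura2024_thm_1_12 ∧ pastenShimura2024_thm_16_5_manyPrimes := by
  refine pasten_thm_1_12_iff_valuationProduct.trans (and_congr ?_ ?_)
  · refine forall₂_congr fun ε _ ↦ exists_congr fun K ↦ and_congr_right fun _ ↦ ?_
    refine forall₂_congr fun W _ ↦ ?_
    rw [isSemistable_iff_squarefree W, valuationProduct_def]
  · refine forall₂_congr fun ε _ ↦ exists_congr fun K ↦ and_congr_right fun _ ↦ ?_
    refine forall₂_congr fun W _ ↦ ?_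
    rw [isSemistable_iff_squarefree W, valuationProduct_def]

/-! ### The first paragraph of the printed proof of Theorem 16.5

"If `N_E = p` is prime then `v_p(Δ_E) ≤ 5` (cf. [MestreOesterle]). The first part of the result
now follows from Corollary 16.2 with `S = ∅`." For a semistable elliptic `W/ℚ` of conductor `N`:
`ω(N) ≥ 2` is Corollary 16.2 with `S = ∅` in its constant form
(`pastenShimura2024_cor_16_2_of_pasten_cor_16_2`, no exceptions left); `ω(N) = 1` means `N = p`
(squarefree) and the product is `v_p(Δ_E) ≤ 5` (`mestreOesterle_factorization_le_five`);
`ω(N) = 0` gives the empty product `1`. -/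

/-- **Prime conductor (Mestre–Oesterlé step)**, the sentence opening the printed proof of
Theorem 16.5. For a semistable elliptic `W/ℚ` with at most one bad prime,
`∏_{p ∣ N} v_p(Δ_E) ≤ 5`: either `N = 1` (empty product) or `N = p` is prime (squarefree with
one prime factor) and the product is `v_p(Δ_E) ≤ 5` (`mestreOesterle_factorization_le_five`).
[cite: PastenShimura2024, Theorem 16.5 (proof)] -/
private theorem prod_le_five_of_card_le_one (h₂ : mestreOesterle_factorization_le_five)
    (W : WeierstrassCurve ℚ) [W.IsElliptic] (hW : W.IsSemistable ℤ)
    (h1 : (W.conductorNorm ℤ).primeFactors.card ≤ 1) :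
    ∏ p ∈ (W.conductorNorm ℤ).primeFactors, (W.minimalDiscriminantNorm ℤ).factorization p ≤ 5 :=
  by
  have hsq : Squarefree (W.conductorNorm ℤ) := (isSemistable_iff_squarefree W).mp hW
  rcases Nat.le_one_iff_eq_zero_or_eq_one.mp h1 with hc | hc
  · rw [Finset.card_eq_zero.mp hc, Finset.prod_empty]
    norm_num
  · obtain ⟨a, ha⟩ := Finset.card_eq_one.mp hc
    have haN : a = W.conductorNorm ℤ := by
      have h := Nat.prod_primeFactors_of_squarefree hsq
      rwa [ha, Finset.prod_singleton] at h
    have hprime : (W.conductorNorm ℤ).Prime :=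
      haN ▸ Nat.prime_of_mem_primeFactors (ha ▸ Finset.mem_singleton_self a)
    rw [ha, Finset.prod_singleton, haN]
    exact h₂ W hprime

/-- **Printed proof of Theorem 16.5, first part** (modulo its two cited inputs, named facts of
this directory): `pasten_cor_16_2 → mestreOesterle_factorization_le_five →
pasten_valuationProduct_semistable` (= Theorem 1.12 = the first display of `pasten_thm_1_12`).
Constant `K_ε = max K 6` with `K = K_{∅,ε}` of the constant form of Corollary 16.2.
[cite: PastenShimura2024, Theorem 16.5 (proof, first part)] -/
theorem pasten_valuationProduct_semistable_of_cor_16_2 (h₁ : pasten_cor_16_2)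
    (h₂ : mestreOesterle_factorization_le_five) : pasten_valuationProduct_semistable := by
  intro ε hε
  obtain ⟨K, hK, hKW⟩ := pastenShimura2024_cor_16_2_of_pasten_cor_16_2 h₁ ∅ ε hε
  refine ⟨max K 6, lt_max_of_lt_left hK, fun W _ hW ↦ ?_⟩
  have hNpos : 0 < W.conductorNorm ℤ := WeierstrassCurve.conductorNorm_pos_holds W
  have hrpow : 1 ≤ (W.conductorNorm ℤ : ℝ) ^ ((11 : ℝ) / 2 + ε) :=
    Real.one_le_rpow (by exact_mod_cast hNpos) (by positivity)
  have hsq : Squarefree (W.conductorNorm ℤ) := (isSemistable_iff_squarefree W).mp hW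
  rcases Nat.lt_or_ge (W.conductorNorm ℤ).primeFactors.card 2 with hcard | hcard
  · -- `ω(N) ≤ 1`: empty product or prime conductor (Mestre–Oesterlé)
    have h5 : (valuationProduct W : ℝ) ≤ 5 := by
      rw [valuationProduct_def]
      exact_mod_cast prod_le_five_of_card_le_one h₂ W hW (by omega)
    have h6 : (6 : ℝ) ≤ max K 6 * (W.conductorNorm ℤ : ℝ) ^ ((11 : ℝ) / 2 + ε) :=
      (le_max_right K 6).trans (le_mul_of_one_le_right (by positivity) hrpow)
    linarith
  · -- `ω(N) ≥ 2`: Corollary 16.2 with `S = ∅` (constant form: no exceptional curves left)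
    have hS : ∀ p : ℕ, p.Prime → p ∉ (∅ : Finset ℕ) → ¬ p ^ 2 ∣ W.conductorNorm ℤ :=
      fun p hp _ h2 ↦ hp.not_isUnit (hsq p (by simpa [sq] using h2))
    have hfilter : (W.conductorNorm ℤ).primeFactors.filter
        (fun p ↦ ¬ p ^ 2 ∣ W.conductorNorm ℤ) = (W.conductorNorm ℤ).primeFactors :=
      Finset.filter_true_of_mem fun p hp ↦ hS p (Nat.prime_of_mem_primeFactors hp) (by simp)
    have h := hKW W hS (by rw [hfilter]; exact hcard)
    rw [valuationProduct_def, ← multiplicativeValuationProduct_eq_of_squarefree W hsq]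
    exact h.trans_le (const_mul_rpow_mono (le_max_left K 6) _ _)

/-- **`pasten_thm_1_12` from the printed proof's inputs.** Corollary 16.2 and Mestre–Oesterlé
give the first display (`pasten_valuationProduct_semistable_of_cor_16_2`); the second display is
Theorem 16.5, second part (`pasten_valuationProduct_semistable_manyPrimes`; its printed proof
rests on Theorem 16.4 (i), not a fact of the tree); assemble with
`pasten_thm_1_12_iff_valuationProduct`. Once `pasten_cor_16_2`,
`mestreOesterle_factorization_le_five` and `pasten_valuationProduct_semistable_manyPrimes` are
discharged, `pasten_thm_1_12_holds` is this theorem applied to their discharges.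
[cite: PastenShimura2024, Theorem 16.5 (proof)] -/
theorem pasten_thm_1_12_of_cor_16_2 (h₁ : pasten_cor_16_2)
    (h₂ : mestreOesterle_factorization_le_five)
    (h₃ : pasten_valuationProduct_semistable_manyPrimes) : pasten_thm_1_12 :=
  pasten_thm_1_12_iff_valuationProduct.mpr
    ⟨pasten_valuationProduct_semistable_of_cor_16_2 h₁ h₂, h₃⟩

end Literature.NumberTheory.EllipticCurves

end
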